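import Summits.BirchSwinnertonDyer.BirchSwinnertonDyer.Theorems.ClassRecordThreeEulerHalvesAtThreeCartanCoverHeckeDatum
import Literature.NumberTheory.Automorphic.QuaternionOrderHeckeJacquetLanglands
import Literature.NumberTheory.Automorphic.ShimuraParametrizationSplitCaseConverseProofs
import HarnessLib

/-!
# (H2) The Hecke–period identity for the unit group of ANY quaternion order: `∫_{z₀}^{γz₀} T_n F = Σ_i ∫_{z₀}^{δ_i z₀} F` — PROVED

Support file for crux `CartanOnePlaceDegreeLawAtThree` (NUM; item stmt-BirchSwinnertonDyer-24801, line `Lines/lattice` v12, last non-cite node (LIFT′)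
`CartanCarayol.CuspidalEigenCochainLiftPrimeToCartanPlaceAtThree`). bsd-idea-10 g20's kernel glue for (LIFT′) needs the Hecke-EQUIVARIANCE of the period map
(Shimura Prop. 8.5) in two halves: (H1) `T_n` preserves `S₂(Γ′)` (cite ∕ later), and (H2) — THIS FILE, THEOREMS ONLY — the period identity ON FUNCTIONS: for
`Γ′ = ι(O¹)` the norm-one group of ANY order `O` of a quaternion algebra with a real splitting `ι` (Literature `normOneUnits ι hO`; the cover group
`CartanCover.coverUnits X q` is the case `O = coverOrder X q`), `F : CuspForm Γ′ 2`, a finite coset space `Γ′∖ι(O(n))` and ANY complete representative system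
(a `HeckeDatum` `(α, σ)` on `Γ′` with `α_i ∈ ι(O(n))` meeting every `Γ′`-coset):
  `segmentIntegral (unitsHeckeFun ι hO n ⇑F) z₀ (γ • z₀) = Σ_i segmentIntegral ⇑F z₀ ((α_i γ α_{σ γ i}⁻¹) • z₀)`
(Shimura (8.3.2) «v(γ) = Σ_i u(α_i γ α_{σ(i)}⁻¹)», weight `2`, trivial coefficients, ON THE NOSE). PROOF: `T_n F = Σ_q F ∣[2] q.out` reindexed along the bijection
`ι ≃ Γ′∖ι(O(n))` (`disj` + covering; `F ∣[2] (u·a) = F ∣[2] a` for `u ∈ Γ′`); segment integrals are additive over finite sums of the continuous functions `F ∣[2] α_i`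
(`CuspForm.translate`); `∫_{z₀}^{γz₀} F∣α_i = ∫_{α_i z₀}^{α_i γ z₀} F` (`segmentIntegral_slash_eq`); `α_i γ = δ_i α_{σ i}` with `δ_i ∈ Γ′`; base-point additivity
(`segmentIntegral_sub_segmentIntegral`) and `Γ′`-invariance telescope the `α`-terms through the permutation `σ γ`. No eigen-hypothesis (this is the OPERATOR form of the
LEAD's `CartanCover.HeckePeriod.period_smul_eq_sum`, p732253). Nothing here is specific to a curve; BSD is proved for no curve.
-/

set_option linter.dupNamespace false
set_option autoImplicit false

noncomputable section

open scoped Classical MatrixGroups ModularForm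
open UpperHalfPlane

namespace Summit.BirchSwinnertonDyer.BirchSwinnertonDyer.Theorems.CartanCover.Charext.InertHecke

open Literature.NumberTheory.Automorphic

section HeckePeriod

variable {B : Type*} [Ring B] [Algebra ℚ B] (ιB : B →ₐ[ℚ] Matrix (Fin 2) (Fin 2) ℝ) {O : Submodule ℤ B}
  (hO : Brandt.IsOrder B O)

/-- Elements of `ι(O(n))` have positive determinant. [folklore] -/
theorem det_pos_of_mem_unitsHeckeSet {n : ℕ} {a : GL (Fin 2) ℝ}
    (ha : a ∈ Literature.NumberTheory.Automorphic.unitsHeckeSet ιB (O := O) n) : 0 < a.det.val := by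
  have hdet : (a : Matrix (Fin 2) (Fin 2) ℝ).det = n := ha.2
  rw [Matrix.GeneralLinearGroup.val_det_apply, hdet]
  have h0 : (a : Matrix (Fin 2) (Fin 2) ℝ).det ≠ 0 := by
    rw [← Matrix.GeneralLinearGroup.val_det_apply]; exact a.det.ne_zero
  rw [hdet] at h0
  exact lt_of_le_of_ne (Nat.cast_nonneg n) (Ne.symm h0)

/-- `Γ′`-invariance of segment integrals: `∫_{δz}^{δw} F = ∫_z^w F` for `δ ∈ Γ′`. [folklore] -/
theorem segmentIntegral_smul_smul_of_mem {Γ : Subgroup (GL (Fin 2) ℝ)} [Γ.HasDetOne] (F : CuspForm Γ 2)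
    {δ : GL (Fin 2) ℝ} (hδ : δ ∈ Γ) (z w : ℍ) : segmentIntegral (⇑F) (δ • z) (δ • w) = segmentIntegral (⇑F) z w := by
  have hdet : 0 < δ.det.val := by rw [Subgroup.HasDetOne.det_eq hδ, Units.val_one]; exact one_pos
  rw [← segmentIntegral_slash_eq F hdet, SlashInvariantForm.slash_action_eqn F δ hδ]

/-- Segment integrals are additive over finite sums of translates `F ∣[2] a_i` (`det a_i > 0`). [folklore] -/
theorem segmentIntegral_sum_slash {Γ : Subgroup (GL (Fin 2) ℝ)} (F : CuspForm Γ 2) {ι : Type*} (s : Finset ι)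
    (a : ι → GL (Fin 2) ℝ) (z w : ℍ) :
    segmentIntegral (fun τ => ∑ i ∈ s, (⇑F ∣[(2 : ℤ)] a i) τ) z w = ∑ i ∈ s, segmentIntegral (⇑F ∣[(2 : ℤ)] a i) z w := by
  unfold segmentIntegral
  rw [← intervalIntegral.integral_finsetSum]
  · refine intervalIntegral.integral_congr fun t _ => ?_
    simp only [Finset.sum_mul]
  · intro i _
    refine ContinuousOn.intervalIntegrable ?_
    rw [Set.uIcc_of_le zero_le_one]
    refine ContinuousOn.mul ?_ continuousOn_const
    have hpath : ∀ t : ℝ, (1 - (t : ℂ)) * (z : ℂ) + (t : ℂ) * (w : ℂ) = (z : ℂ) + (t : ℂ) * ((w : ℂ) - (z : ℂ)) := fun t => by ring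
    have hc : ContinuousOn (fun t : ℝ => (CuspForm.translate F (a i)) (ofComplex ((z : ℂ) + (t : ℂ) * ((w : ℂ) - (z : ℂ)))))
        (Set.Icc (0 : ℝ) 1) :=
      (differentiableOn_cuspForm_comp_ofComplex (CuspForm.translate F (a i))).continuousOn.comp
        (by fun_prop : Continuous fun t : ℝ => (z : ℂ) + (t : ℂ) * ((w : ℂ) - (z : ℂ))).continuousOn
        fun t ht => im_pos_of_mem_segment z w ht.1 ht.2
    refine hc.congr fun t _ => ?_
    simp only [hpath]
    rfl

/-- **(H2) THE HECKE–PERIOD IDENTITY, operator form.** For `Γ′ = normOneUnits ι hO`, `F : CuspForm Γ′ 2`, `n` with `Γ′∖ι(O(n))` finite and ANY Hecke datum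
`(α, σ)` on `Γ′` whose representatives lie in `ι(O(n))` and meet every `Γ′`-coset:
`∫_{z₀}^{γ z₀} T_n F = Σ_i ∫_{z₀}^{(α_i γ α_{σ γ i}⁻¹) z₀} F` (`T_n = unitsHeckeFun ι hO n` on functions). [cite: ShimuraIATAF1971, §8.3 (8.3.2) and Prop. 8.5] -/
theorem segmentIntegral_unitsHeckeFun_eq_sum (n : ℕ) [Fintype (Quotient (unitsHeckeSetoid ιB hO n))]
    (F : CuspForm (normOneUnits ιB hO) 2) {ι : Type*} [Fintype ι] (H : HeckeDatum (normOneUnits ιB hO) ι)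
    (hα : ∀ i, H.α i ∈ Literature.NumberTheory.Automorphic.unitsHeckeSet ιB (O := O) n)
    (hcov : ∀ g ∈ Literature.NumberTheory.Automorphic.unitsHeckeSet ιB (O := O) n, ∃ i, ∃ u ∈ normOneUnits ιB hO, u * g = H.α i)
    (z₀ : ℍ) (γ : normOneUnits ιB hO) :
    segmentIntegral (unitsHeckeFun ιB hO n ⇑F) z₀ ((γ : GL (Fin 2) ℝ) • z₀) =
      ∑ i, segmentIntegral (⇑F) z₀ ((H.α i * (γ : GL (Fin 2) ℝ) * (H.α (H.σ γ i))⁻¹) • z₀) := by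
  classical
  -- (a) the bijection `ι ≃ Γ′∖ι(O(n))`
  let f : ι → Quotient (unitsHeckeSetoid ιB hO n) := fun i => Quotient.mk _ ⟨H.α i, hα i⟩
  have hf_inj : Function.Injective f := by
    intro i j hij
    obtain ⟨u, hu, hu'⟩ := Quotient.exact hij
    -- `u * α i = α j`
    have : H.α j = u * H.α i := by simpa using hu'.symm
    exact (H.disj j i u hu this).symm ▸ rfl
  have hf_surj : Function.Surjective f := by
    intro q
    induction q using Quotient.inductionOn with
    | h a =>
      obtain ⟨i, u, hu, hua⟩ := hcov a a.2
      refine ⟨i, Quotient.sound ?_⟩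
      exact ⟨u⁻¹, inv_mem hu, by
        show u⁻¹ * H.α i = (a : GL (Fin 2) ℝ)
        rw [← hua, inv_mul_cancel_left]⟩
  let e : ι ≃ Quotient (unitsHeckeSetoid ιB hO n) := Equiv.ofBijective f ⟨hf_inj, hf_surj⟩
  -- each `q.out` differs from `α (e.symm q)` by a unit, so the slashes agree
  have hslash : ∀ i, (⇑F ∣[(2 : ℤ)] ((((e i).out : Literature.NumberTheory.Automorphic.unitsHeckeSet ιB (O := O) n)) : GL (Fin 2) ℝ)) =
      ⇑F ∣[(2 : ℤ)] H.α i := by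
    intro i
    have hq : Quotient.mk (unitsHeckeSetoid ιB hO n) (e i).out = f i := by
      rw [Quotient.out_eq]; rfl
    obtain ⟨u, hu, hu'⟩ := Quotient.exact hq
    have e1 : u * ((((e i).out : Literature.NumberTheory.Automorphic.unitsHeckeSet ιB (O := O) n)) : GL (Fin 2) ℝ) = H.α i := by
      simpa using hu'
    rw [← e1, SlashAction.slash_mul, SlashInvariantForm.slash_action_eqn F u hu]
  have hT : unitsHeckeFun ιB hO n ⇑F = fun τ => ∑ i, (⇑F ∣[(2 : ℤ)] H.α i) τ := by
    funext τ
    rw [unitsHeckeFun_apply, finsum_eq_sum_of_fintype]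
    rw [← Equiv.sum_comp e (fun q => (⇑F ∣[(2 : ℤ)] (((q.out : Literature.NumberTheory.Automorphic.unitsHeckeSet ιB (O := O) n)) : GL (Fin 2) ℝ)) τ)]
    exact Finset.sum_congr rfl fun i _ => by rw [hslash]
  -- (b) termwise: `∫_{z₀}^{γz₀} F∣α_i = ∫_{α_i z₀}^{α_i γ z₀} F = ∫_{α_i z₀}^{δ_i α_{σ i} z₀} F`
  rw [hT, segmentIntegral_sum_slash F Finset.univ H.α z₀ ((γ : GL (Fin 2) ℝ) • z₀)]
  set δ : ι → GL (Fin 2) ℝ := fun i => H.α i * (γ : GL (Fin 2) ℝ) * (H.α (H.σ γ i))⁻¹ with hδ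
  have hδmem : ∀ i, δ i ∈ normOneUnits ιB hO := fun i => H.mem γ i
  have hαγ : ∀ i, H.α i • (γ : GL (Fin 2) ℝ) • z₀ = δ i • H.α (H.σ γ i) • z₀ := by
    intro i
    rw [← mul_smul, ← mul_smul, hδ]
    congr 1
    rw [inv_mul_cancel_right]
  -- `P w := ∫_{z₀}^w F`; term_i = per(δ_i) + P(α_{σ i} z₀) - P(α_i z₀)
  have hterm : ∀ i, segmentIntegral (⇑F ∣[(2 : ℤ)] H.α i) z₀ ((γ : GL (Fin 2) ℝ) • z₀) =
      segmentIntegral (⇑F) z₀ (δ i • z₀) + (segmentIntegral (⇑F) z₀ (H.α (H.σ γ i) • z₀) - segmentIntegral (⇑F) z₀ (H.α i • z₀)) := by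
    intro i
    rw [segmentIntegral_slash_eq F (det_pos_of_mem_unitsHeckeSet ιB (hα i)), hαγ]
    have e1 := segmentIntegral_sub_segmentIntegral F z₀ (H.α i • z₀) (δ i • H.α (H.σ γ i) • z₀)
    have e2 := segmentIntegral_sub_segmentIntegral F z₀ (δ i • z₀) (δ i • H.α (H.σ γ i) • z₀)
    have e3 := segmentIntegral_smul_smul_of_mem F (hδmem i) z₀ (H.α (H.σ γ i) • z₀)
    linear_combination (-1 : ℂ) * e1 + e2 + e3
  simp_rw [hterm]
  rw [Finset.sum_add_distrib, Finset.sum_sub_distrib,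
    Equiv.sum_comp (H.σ γ) (fun i => segmentIntegral (⇑F) z₀ (H.α i • z₀)), sub_self, add_zero]

end HeckePeriod

end Summit.BirchSwinnertonDyer.BirchSwinnertonDyer.Theorems.CartanCover.Charext.InertHecke

end
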